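import Mathlib
import Summits.Ventures.PercRepro2.Defs
import Summits.Ventures.PercRepro2.Graph
import Summits.Ventures.PercRepro2.Harris
import Summits.Ventures.PercRepro2.Events
import Summits.Ventures.PercRepro2.Independence
import Summits.Ventures.PercRepro2.Induced
import Summits.Ventures.PercRepro2.Exploration
import Summits.Ventures.PercRepro2.GateDefs
import Summits.Ventures.PercRepro2.GateAnatomy
import Summits.Ventures.PercRepro2.GateForest
import Summits.Ventures.PercRepro2.GateLSM
import Summits.Ventures.PercRepro2.HullTree
import Summits.Ventures.PercRepro2.GateFeedbackForest
import Summits.Ventures.PercRepro2.GateFeedback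
import Summits.Ventures.PercRepro2.GateFeedbackExit
import Summits.Ventures.PercRepro2.GateContract
import Summits.Ventures.PercRepro2.GateShadow
import Summits.Ventures.PercRepro2.GateSide
import Summits.Ventures.PercRepro2.GateSep
import Summits.Ventures.PercRepro2.SideCluster
import Summits.Ventures.PercRepro2.CactusDefs
import Summits.Ventures.PercRepro2.CactusTriangle
import Summits.Ventures.PercRepro2.CactusTriangleMass
import Summits.Ventures.PercRepro2.CactusCluster
import Summits.Ventures.PercRepro2.CactusChain

/-!
# The hull-connection factor is log-supermodular on root clusters of a triangular cactus
(blind cell PercRepro2, mine-c g11; proofs/MINEC-FEEDBACK.md §14; the gate is drawn in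
`CactusGate.lean`)

`κ(W) = P(t ↔ w in G ∖ W)` (`connDelEvent ends W t w`). By the CHAIN LEMMA (`CactusChain.chain`),
for two root clusters `W₁, W₂` of the cactus `G − t` the component of `w` in `G − t − W₁` misses
`W₂` or the component of `w` in `G − t − W₂` misses `W₁`. In the first case every open connection
`t ↔ w` avoiding `W₁` avoids `W₂` as well (`connDelEvent_subset_of_not_reach`: take the first
arrival at `t`; the chain before it lives in `G − t − W₁`, hence outside `W₂`), so
`κ(W₁) ≤ κ(W₁ ∪ W₂)`, while `κ(W₂) ≤ κ(W₁ ∩ W₂)` by antitonicity — hence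
`κ(W₁) κ(W₂) ≤ κ(W₁ ∩ W₂) κ(W₁ ∪ W₂)` (`kappa_lsm`). No block paths and no frontier order.
-/

namespace Summit.Ventures.PercRepro2

namespace CactusGate

open Cactus CactusChain GateSide

open scoped Classical

variable {V : Type*} {E : Type*} [Fintype E] [Fintype V]
variable {R : Type*} [Field R] [LinearOrder R] [IsStrictOrderedRing R]

/-! ## First arrival -/

omit [Fintype E] [Fintype V] in
/-- **First arrival.** A reflexive-transitive chain from `a` to `t` either starts at `t` or reaches
some `v ≠ t` through steps never leaving `t` and then steps from `v` to `t`. -/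
lemma exists_first_arrival {α : Type*} {r : α → α → Prop} {t a : α}
    (h : Relation.ReflTransGen r a t) :
    a = t ∨ ∃ v, Relation.ReflTransGen (fun x y => r x y ∧ x ≠ t) a v ∧ v ≠ t ∧ r v t := by
  induction h using Relation.ReflTransGen.head_induction_on with
  | refl => exact Or.inl rfl
  | head hac hct ih =>
    rename_i a c
    by_cases hat : a = t
    · exact Or.inl hat
    · rcases ih with hct' | ⟨v, hcv, hvt, hrvt⟩
      · subst hct'
        exact Or.inr ⟨a, Relation.ReflTransGen.refl, hat, hac⟩
      · exact Or.inr ⟨v, Relation.ReflTransGen.head ⟨hac, hat⟩ hcv, hvt, hrvt⟩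

omit [Fintype E] [Fintype V] in
/-- A chain of `G₁` never leaving `t`, ending at `v ≠ t`, is a reachability of every graph `G₂`
containing the `G₁`-adjacencies between vertices `≠ t`. -/
lemma reachable_of_reflTransGen_avoid {G₁ G₂ : SimpleGraph V} {t : V}
    (hadj : ∀ a b, a ≠ t → b ≠ t → G₁.Adj a b → G₂.Adj a b) {w v : V}
    (h : Relation.ReflTransGen (fun x y => G₁.Adj x y ∧ x ≠ t) w v) (hv : v ≠ t) :
    G₂.Reachable w v := by
  revert hv
  induction h with
  | refl => intro _; exact SimpleGraph.Reachable.refl w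
  | tail _ hbc ih => intro hc; exact (ih hbc.2).trans (hadj _ _ hbc.2 hc hbc.1).reachable

variable {ends : E → Sym2 V}

omit [Fintype E] [Fintype V] in
/-- An edge with both endpoints outside `S` does not touch `S`. -/
lemma notMem_touches_of_ends {S : Set V} {e : E} {a b : V} (hends : ends e = s(a, b))
    (ha : a ∉ S) (hb : b ∉ S) : e ∉ touches ends S := by
  rintro ⟨x, hx, y, hxy⟩
  rw [hends, Sym2.eq_iff] at hxy
  rcases hxy with ⟨h1, _⟩ | ⟨_, h2⟩
  · exact ha (by rw [h1]; exact hx)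
  · exact hb (by rw [h2]; exact hx)

omit [Fintype E] [Fintype V] in
/-- An open adjacency of a configuration whose open edges avoid `W`, between vertices `≠ t`, is an
adjacency of `G − t − W`. -/
lemma adj_delCfg_of_adj {W : Set V} {t : V} {ω₁ : Config E}
    (hspec : ∀ e, ω₁ e = true → e ∉ touches ends W) {a b : V} (hat : a ≠ t) (hbt : b ≠ t)
    (hab : (openGraph ends ω₁).Adj a b) :
    (openGraph ends (delCfg ends (GateFeedback.Ft ends t) W)).Adj a b := by
  rw [openGraph_adj] at hab ⊢
  obtain ⟨hne, e, he, hends⟩ := hab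
  refine ⟨hne, e, delCfg_eq_true_iff.2 ⟨?_, hspec e he⟩, hends⟩
  show t ∉ ends e
  rw [hends, Sym2.mem_iff]
  rintro (h | h)
  · exact hat h.symm
  · exact hbt h.symm

omit [Fintype E] in
/-- **Step (B).** If `w` reaches no vertex of `W₂` in `G − t − W₁`, every open connection `t ↔ w`
avoiding `W₁` avoids `W₂` as well: `{t ↔ w in G ∖ W₁} ⊆ {t ↔ w in G ∖ (W₁ ∪ W₂)}`. -/
lemma connDelEvent_subset_of_not_reach {W₁ W₂ : Finset V} {t w : V} (ht₂ : t ∉ W₂)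
    (hwt : w ≠ t)
    (hK : ∀ y ∈ W₂, ¬ Conn ends (delCfg ends (GateFeedback.Ft ends t) (↑W₁ : Set V)) w y) :
    connDelEvent ends W₁ t w ⊆ connDelEvent ends (W₁ ∪ W₂) t w := by
  intro ω hω
  rw [mem_connDelEvent] at hω ⊢
  -- instance-free forms of the hypothesis and of the goal
  obtain ⟨ω₁, hspec, hc⟩ : ∃ ω₁ : Config E,
      (∀ e, ω₁ e = true → ω e = true ∧ e ∉ touches ends (↑W₁ : Set V)) ∧ Conn ends ω₁ t w :=
    ⟨_, fun e he => restrict_eq_true_iff.1 he, hω⟩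
  suffices key : ∀ ω₁₂ : Config E,
      (∀ e, ω e = true → e ∉ touches ends (↑(W₁ ∪ W₂) : Set V) → ω₁₂ e = true) →
      Conn ends ω₁₂ t w from key _ (fun e he hne => restrict_eq_true_iff.2 ⟨he, hne⟩)
  intro ω₁₂ hω₁₂
  have h := (SimpleGraph.reachable_iff_reflTransGen _ _).1 (conn_symm hc)
  -- (i) chains never leaving `t` are reachabilities of `G − t − W₁`
  have hlift : ∀ v, Relation.ReflTransGen (fun x y => (openGraph ends ω₁).Adj x y ∧ x ≠ t) w v →
      v ≠ t → Conn ends (delCfg ends (GateFeedback.Ft ends t) (↑W₁ : Set V)) w v :=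
    fun v hv hvt => reachable_of_reflTransGen_avoid
      (fun a b hat hbt hab => adj_delCfg_of_adj (fun e he => (hspec e he).2) hat hbt hab) hv hvt
  -- (ii) every vertex of such a chain lies outside `W₂`
  have hout : ∀ v, Relation.ReflTransGen (fun x y => (openGraph ends ω₁).Adj x y ∧ x ≠ t) w v →
      v ∉ W₂ := by
    intro v hv hvW
    have hvt : v ≠ t := fun h => ht₂ (h ▸ hvW)
    exact hK v hvW (hlift v hv hvt)
  -- membership in `↑(W₁ ∪ W₂)`
  have hcoe : ∀ v, v ∉ W₁ → v ∉ W₂ → v ∉ (↑(W₁ ∪ W₂) : Set V) := by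
    intro v h1 h2 h
    rcases Finset.mem_union.1 (Finset.mem_coe.1 h) with h | h
    · exact h1 h
    · exact h2 h
  -- an open edge of `ω₁` between vertices outside `W₂` is open in `ω₁₂`
  have hedge : ∀ e a b, ω₁ e = true → ends e = s(a, b) → a ∉ W₂ → b ∉ W₂ →
      OpenAdj ends ω₁₂ a b := by
    intro e a b he hends ha hb
    obtain ⟨he, heW₁⟩ := hspec e he
    obtain ⟨ha₁, hb₁⟩ := not_mem_of_not_mem_touches hends heW₁
    exact ⟨e, hω₁₂ e he (notMem_touches_of_ends hends
      (hcoe a (fun h => ha₁ (Finset.mem_coe.2 h)) ha)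
      (hcoe b (fun h => hb₁ (Finset.mem_coe.2 h)) hb)), hends⟩
  -- (iii) the chain lives in `ω₁₂`
  have hchain : ∀ v, Relation.ReflTransGen (fun x y => (openGraph ends ω₁).Adj x y ∧ x ≠ t) w v →
      Conn ends ω₁₂ w v := by
    intro v hv
    induction hv with
    | refl => exact conn_refl _ _ _
    | tail hab hbc ih =>
      rename_i b c
      refine conn_trans ih ?_
      have hb₂ : b ∉ W₂ := hout b hab
      have hc₂ : c ∉ W₂ := hout c (hab.tail hbc)
      obtain ⟨hadj, _⟩ := hbc
      rw [openGraph_adj] at hadj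
      obtain ⟨_, e, he, hends⟩ := hadj
      exact conn_of_openAdj (hedge e b c he hends hb₂ hc₂)
  rcases exists_first_arrival h with hwt' | ⟨v, hwv, hvt, hadj⟩
  · exact (hwt hwt').elim
  · refine conn_symm (conn_trans (hchain v hwv) ?_)
    have hv₂ : v ∉ W₂ := hout v hwv
    rw [openGraph_adj] at hadj
    obtain ⟨_, e, he, hends⟩ := hadj
    exact conn_of_openAdj (hedge e v t he hends hv₂ ht₂)

omit [Fintype E] [Fintype V] in
/-- `restrict` is monotone in the edge set (any decidability instances). -/
lemma restrict_le_restrict {F F' : Set E} [DecidablePred (· ∈ F)] [DecidablePred (· ∈ F')]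
    (h : F ⊆ F') (ω : Config E) : restrict F ω ≤ restrict F' ω := by
  intro e
  by_cases he : e ∈ F
  · rw [restrict_apply_of_mem he, restrict_apply_of_mem (h he)]
  · rw [restrict_apply_of_notMem he]; exact Bool.false_le _

omit [Fintype E] in
/-- `{t ↔ w in G ∖ W}` is antitone in `W`. -/
lemma connDelEvent_anti {W W' : Finset V} (h : W ⊆ W') (t w : V) :
    connDelEvent ends W' t w ⊆ connDelEvent ends W t w := by
  intro ω hω
  rw [mem_connDelEvent] at hω ⊢
  refine conn_mono (restrict_le_restrict ?_ ω) hω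
  intro e he
  rw [Set.mem_compl_iff] at he ⊢
  intro h'
  apply he
  obtain ⟨x, hx, y, hxy⟩ := h'
  exact ⟨x, Finset.mem_coe.2 (h (Finset.mem_coe.1 hx)), y, hxy⟩

/-! ## `κ` is log-supermodular on a pair of clusters whose exit components are nested -/

/-- **The dichotomy gives the inequality** (any graph): if `w` reaches no vertex of `W₂` in
`G − t − W₁` or no vertex of `W₁` in `G − t − W₂`, then
`κ(W₁) κ(W₂) ≤ κ(W₁ ∩ W₂) κ(W₁ ∪ W₂)`. -/
theorem kappa_lsm_of_dichotomy {p : E → R} (hp : IsProbVec p) {t w : V} {W₁ W₂ : Finset V}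
    (ht₁ : t ∉ W₁) (ht₂ : t ∉ W₂) (hwt : w ≠ t)
    (hd : (∀ y ∈ W₂, ¬ Conn ends (delCfg ends (GateFeedback.Ft ends t) (↑W₁ : Set V)) w y) ∨
      (∀ y ∈ W₁, ¬ Conn ends (delCfg ends (GateFeedback.Ft ends t) (↑W₂ : Set V)) w y)) :
    prob p (connDelEvent ends W₁ t w) * prob p (connDelEvent ends W₂ t w) ≤
      prob p (connDelEvent ends (W₁ ∩ W₂) t w) * prob p (connDelEvent ends (W₁ ∪ W₂) t w) := by
  have hκ0 : ∀ W, 0 ≤ prob p (connDelEvent ends W t w) := fun W => prob_nonneg hp _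
  rcases hd with hd | hd
  · have e1 : connDelEvent ends W₁ t w ⊆ connDelEvent ends (W₁ ∪ W₂) t w :=
      connDelEvent_subset_of_not_reach ht₂ hwt hd
    have e2 : connDelEvent ends W₂ t w ⊆ connDelEvent ends (W₁ ∩ W₂) t w :=
      connDelEvent_anti Finset.inter_subset_right t w
    calc prob p (connDelEvent ends W₁ t w) * prob p (connDelEvent ends W₂ t w)
        ≤ prob p (connDelEvent ends (W₁ ∪ W₂) t w) * prob p (connDelEvent ends (W₁ ∩ W₂) t w) :=
          mul_le_mul (prob_mono hp e1) (prob_mono hp e2) (hκ0 _) (hκ0 _)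
      _ = _ := mul_comm _ _
  · have e1 : connDelEvent ends W₂ t w ⊆ connDelEvent ends (W₁ ∪ W₂) t w := by
      rw [Finset.union_comm]
      exact connDelEvent_subset_of_not_reach ht₁ hwt hd
    have e2 : connDelEvent ends W₁ t w ⊆ connDelEvent ends (W₁ ∩ W₂) t w :=
      connDelEvent_anti Finset.inter_subset_left t w
    exact mul_le_mul (prob_mono hp e2) (prob_mono hp e1) (hκ0 _) (hκ0 _)

/-! ## `κ` is log-supermodular on root clusters of the cactus `G − t` -/

/-- **The hull-connection factor is log-supermodular on root clusters** when `G − t` is a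
triangular cactus: for root clusters `W₁ = C(s)(ω₁)`, `W₂ = C(s)(ω₂)` of `G − t` avoiding `t, w`,
`κ(W₁) κ(W₂) ≤ κ(W₁ ∩ W₂) κ(W₁ ∪ W₂)` (the chain lemma gives the dichotomy). -/
theorem kappa_lsm {p : E → R} (hp : IsProbVec p) {s t w : V}
    (hF : IsCactusFrom ends s (GateFeedback.Ft ends t)) {W₁ W₂ : Finset V} {ω₁ ω₂ : Config E}
    (h₁ : clusterOn ends (GateFeedback.Ft ends t) ω₁ s = ↑W₁)
    (h₂ : clusterOn ends (GateFeedback.Ft ends t) ω₂ s = ↑W₂)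
    (ht₁ : t ∉ W₁) (ht₂ : t ∉ W₂) (hw₁ : w ∉ W₁) (hw₂ : w ∉ W₂) (hwt : w ≠ t) :
    prob p (connDelEvent ends W₁ t w) * prob p (connDelEvent ends W₂ t w) ≤
      prob p (connDelEvent ends (W₁ ∩ W₂) t w) * prob p (connDelEvent ends (W₁ ∪ W₂) t w) := by
  refine kappa_lsm_of_dichotomy hp ht₁ ht₂ hwt ?_
  by_cases hr : ∃ y ∈ W₂, Conn ends (delCfg ends (GateFeedback.Ft ends t) (↑W₁ : Set V)) w y
  · -- `w` reaches `W₂` around `W₁`: by the chain lemma it does not reach `W₁` around `W₂`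
    refine Or.inr fun y hy hc => ?_
    refine CactusChain.chain hF w ω₁ ω₂ ?_ ?_ ?_ ?_
    · rw [h₁]; exact fun h => hw₁ (Finset.mem_coe.1 h)
    · rw [h₂]; exact fun h => hw₂ (Finset.mem_coe.1 h)
    · rw [h₁, h₂]
      obtain ⟨y', hy', hc'⟩ := hr
      exact ⟨y', Finset.mem_coe.2 hy', hc'⟩
    · rw [h₁, h₂]
      exact ⟨y, Finset.mem_coe.2 hy, hc⟩
  · exact Or.inl fun y hy hc => hr ⟨y, hy, hc⟩

end CactusGate

end Summit.Ventures.PercRepro2
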